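import Literature.NumberTheory.Automorphic.CuspidalCohomologyGL
import HarnessLib

/-!
# Integral functions in the twisted coefficient representation and their untwisting

Topic `NumberTheory/Automorphic`; namespace `Literature.NumberTheory.Automorphic`, grouping
sub-namespace `TwistedQuotient`.  Definitions with bodies and theorems; no named fact.

Setting of [Scholze2015, §V.4, before Thm. V.4.1] ("an algebraic representation `ξ` … with
coefficients in a finite free `ℤ̄_p`-module `M_ξ` … defines a local system `ℳ_{ξ,K}` of
`ℤ̄_p`-modules on `X_K`"), for the stacky quotients of the tree: `π` is a representation of the
BIG group `𝒢` (e.g. `GL_n(𝔸_K^∞)` acting on `⨂_τ V_{λ_τ}` through its `p`-component) on an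
`A`-module `V`, `ρ = π ∘ ι` its restriction to `Γ` (e.g. `GL_n(K)`), `L ≤ 𝒢` a level and
`M ⊆ V` an `A`-submodule stable under `π(L)` (a lattice).

* `intFunSubmodule` / `intFunSubrep` / `intFun ι L π M hM`: the `Γ`-subrepresentation
  `M̃ = {f : 𝒢 ⧸ L → V | π(g)⁻¹ f(gL) ∈ M}` of the twisted coefficients `Fun(𝒢 ⧸ L, V)_ρ`
  (`coeffRep ι L (π.comp ι)`) — the integral structure `ℳ_{ξ,K}` — with its inclusion `intFunι`;
* `indFunSubmodule` / `indFun ι L σ`: for a representation `σ` of `L` on `N`, the induced-type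
  `Γ`-representation `{F : 𝒢 → N | F(g l) = σ(l)⁻¹ F(g)}` with `Γ` acting by LEFT translation only;
* **`intFunIso : intFun ≅ indFun (σ := π|_L on M)`**, `f ↦ (g ↦ π(g)⁻¹ f(gL))` — the untwisting:
  the twist by `ρ` is traded for the `L`-equivariance condition, which is what makes the reduction
  modulo `p^m` a function space with trivial `Γ`-coefficients at a level `K' ⊆ K` acting trivially on
  `M/p^m` [Scholze2015, §V.4, proof of Thm. V.4.1];
* `heckeFun_mem_intFunSubmodule`, `heckeIntHom`, `heckeIntHom_comp_intFunι`: `M̃` is stable under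
  the Hecke operator `[L g₀ L]` as soon as `π(g₀) M ⊆ M` (e.g. `g₀` with trivial `p`-component), and
  the operator on `M̃` is the restriction of the one on `Fun(𝒢 ⧸ L, V)_ρ`.

## References

* P. Scholze, *On torsion in the cohomology of locally symmetric varieties*, Ann. of Math. 182
  (2015), §V.4 [Scholze2015].
-/

noncomputable section

open CategoryTheory

universe u

namespace Literature.NumberTheory.Automorphic

namespace TwistedQuotient

variable {A : Type u} [CommRing A] {Γ 𝒢 : Type u} [Group Γ] [Group 𝒢] (ι : Γ →* 𝒢)
  (L : Subgroup 𝒢) {V : Type u} [AddCommGroup V] [Module A V] (π : Representation A 𝒢 V)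

/-- `π(g) (π(g⁻¹) v) = v`. [folklore] -/
theorem rep_apply_inv_apply (g : 𝒢) (v : V) : π g (π g⁻¹ v) = v := by
  rw [← Module.End.mul_apply, ← map_mul, mul_inv_cancel, map_one, Module.End.one_apply]

/-- `π(g⁻¹) (π(g) v) = v`. [folklore] -/
theorem rep_inv_apply_apply (g : 𝒢) (v : V) : π g⁻¹ (π g v) = v := by
  rw [← Module.End.mul_apply, ← map_mul, inv_mul_cancel, map_one, Module.End.one_apply]

/-! ### Integral functions `M̃ ⊆ Fun(𝒢 ⧸ L, V)_ρ` -/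

section IntFun

variable (M : Submodule A V)

/-- The `A`-submodule `M̃ = {f | π(g)⁻¹ f(gL) ∈ M for all g}` of `Fun(𝒢 ⧸ L, V)` ("`f(gL) ∈ g M`").
[cite: Scholze2015, §V.4, before Thm. V.4.1] -/
def intFunSubmodule : Submodule A ((𝒢 ⧸ L) → V) where
  carrier := {f | ∀ g : 𝒢, π g⁻¹ (f (g : 𝒢 ⧸ L)) ∈ M}
  zero_mem' g := by simp
  add_mem' {f f'} hf hf' g := by
    simp only [Pi.add_apply, map_add]
    exact M.add_mem (hf g) (hf' g)
  smul_mem' a f hf g := by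
    simp only [Pi.smul_apply, map_smul]
    exact M.smul_mem a (hf g)

/-- Membership in `M̃`. [folklore] -/
theorem mem_intFunSubmodule_iff (f : (𝒢 ⧸ L) → V) :
    f ∈ intFunSubmodule L π M ↔ ∀ g : 𝒢, π g⁻¹ (f (g : 𝒢 ⧸ L)) ∈ M :=
  Iff.rfl

variable (hM : ∀ l ∈ L, ∀ m ∈ M, π l m ∈ M)

/-- `M̃` is stable under the twisted `Γ`-action `(γ f)(c) = π(ι γ) f(ι(γ)⁻¹ c)`. [folklore] -/
theorem coeffRepresentation_mem_intFunSubmodule (γ : Γ) {f : (𝒢 ⧸ L) → V}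
    (hf : f ∈ intFunSubmodule L π M) :
    coeffRepresentation ι L (π.comp ι) γ f ∈ intFunSubmodule L π M := by
  intro g
  rw [coeffRepresentation_apply, MonoidHom.comp_apply, MulAction.Quotient.smul_coe, smul_eq_mul,
    ← Module.End.mul_apply, ← map_mul, show g⁻¹ * ι γ = ((ι γ)⁻¹ * g)⁻¹ by
      rw [mul_inv_rev, inv_inv]]
  exact hf _

omit hM in
/-- `M̃` as a `Γ`-subrepresentation of `Fun(𝒢 ⧸ L, V)_ρ`, `ρ = π ∘ ι`. [folklore] -/
def intFunSubrep : Subrepresentation (coeffRepresentation ι L (π.comp ι)) where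
  toSubmodule := intFunSubmodule L π M
  apply_mem_toSubmodule γ _ hf := coeffRepresentation_mem_intFunSubmodule ι L π M γ hf

/-- **`M̃`**, the integral twisted coefficient representation, as an object of `Rep A Γ`.
[cite: Scholze2015, §V.4, before Thm. V.4.1] -/
abbrev intFun : Rep A Γ :=
  Rep.of (intFunSubrep ι L π M).toRepresentation

/-- The inclusion `M̃ ⟶ Fun(𝒢 ⧸ L, V)_ρ`. [folklore] -/
def intFunι : intFun ι L π M ⟶ coeffRep ι L (π.comp ι) :=
  Rep.ofHom ⟨(intFunSubmodule L π M).subtype, fun _ => LinearMap.ext fun _ => rfl⟩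

/-- Unfolding lemma for `intFunι`. [folklore] -/
@[simp]
theorem intFunι_hom_apply (f : intFun ι L π M) : (intFunι ι L π M).hom f = f.1 :=
  rfl

/-- `intFunι` is injective. [folklore] -/
theorem intFunι_injective : Function.Injective (intFunι ι L π M).hom :=
  Subtype.val_injective

/-! ### Hecke stability of `M̃` -/

variable {g₀ : 𝒢} (hg₀ : ∀ m ∈ M, π g₀ m ∈ M)

include hM hg₀ in
/-- **`M̃` is stable under `[L g₀ L]`** when `π(L) M ⊆ M` and `π(g₀) M ⊆ M`: every term
`f(x a g₀ L)`, `a ∈ L`, of `(T_{g₀} f)(xL)` lies in `π(x a g₀) M ⊆ π(x) M`.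
[cite: Scholze2015, §V.4 (𝕋_{F,S} acts on H^i(X_K, ℳ_{ξ,K}))] -/
theorem heckeFun_mem_intFunSubmodule {f : (𝒢 ⧸ L) → V} (hf : f ∈ intFunSubmodule L π M) :
    ArithmeticQuotient.heckeFun A L g₀ V f ∈ intFunSubmodule L π M := by
  classical
  intro g
  rw [ArithmeticQuotient.heckeFun_apply]
  split_ifs with hfin
  · rw [map_sum]
    refine Submodule.sum_mem _ fun d hd => ?_
    rw [Set.Finite.mem_toFinset] at hd
    obtain ⟨a, rfl⟩ := hd
    obtain ⟨l₀, hl₀⟩ := QuotientGroup.mk_out_eq_mul L g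
    change π g⁻¹ (f ((g : 𝒢 ⧸ L).out • ((a : 𝒢) • (g₀ : 𝒢 ⧸ L)))) ∈ M
    rw [hl₀, MulAction.Quotient.smul_coe, MulAction.Quotient.smul_coe, smul_eq_mul, smul_eq_mul]
    have key : π g⁻¹ (f ((g * l₀ * (a * g₀) : 𝒢) : 𝒢 ⧸ L)) =
        π ((l₀ : 𝒢) * a * g₀) (π (g * l₀ * (a * g₀))⁻¹ (f ((g * l₀ * (a * g₀) : 𝒢) : 𝒢 ⧸ L))) := by
      rw [← Module.End.mul_apply, ← map_mul]
      congr 2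
      group
    rw [key, map_mul, map_mul, Module.End.mul_apply, Module.End.mul_apply]
    exact hM _ l₀.2 _ (hM _ a.2 _ (hg₀ _ (hf _)))
  · rw [map_zero]
    exact M.zero_mem

/-- **The Hecke operator `[L g₀ L]` on `M̃`** (restriction of `heckeRepHom ι L ρ g₀`).
[cite: Scholze2015, §V.4] -/
def heckeIntHom : intFun ι L π M ⟶ intFun ι L π M :=
  Rep.ofHom ⟨(ArithmeticQuotient.heckeFun A L g₀ V).restrict fun _ hf =>
      heckeFun_mem_intFunSubmodule L π M hM hg₀ hf,
    fun γ => LinearMap.ext fun f => Subtype.ext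
      (heckeFun_coeffRepresentation ι L (π.comp ι) g₀ γ f.1)⟩

/-- `heckeIntHom` is `[L g₀ L]` on functions. [folklore] -/
@[simp]
theorem val_heckeIntHom_hom_apply (f : intFun ι L π M) :
    ((heckeIntHom ι L π M hM hg₀).hom f).1 = ArithmeticQuotient.heckeFun A L g₀ V f.1 :=
  rfl

/-- The Hecke operators on `M̃` and on `Fun(𝒢 ⧸ L, V)_ρ` agree under the inclusion. [folklore] -/
theorem heckeIntHom_comp_intFunι :
    heckeIntHom ι L π M hM hg₀ ≫ intFunι ι L π M =
      intFunι ι L π M ≫ heckeRepHom ι L (π.comp ι) g₀ :=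
  Rep.hom_ext (Representation.IntertwiningMap.ext (LinearMap.ext fun _ => rfl))

end IntFun

/-! ### The induced-type representation `{F : 𝒢 → N | F(g l) = σ(l)⁻¹ F(g)}` -/

section IndFun

variable {N : Type u} [AddCommGroup N] [Module A N] (σ : Representation A L N)

/-- The `A`-submodule `{F : 𝒢 → N | F(g l) = σ(l)⁻¹ F(g)}` of `Fun(𝒢, N)`. [folklore] -/
def indFunSubmodule : Submodule A (𝒢 → N) where
  carrier := {F | ∀ (g : 𝒢) (l : L), F (g * l) = σ l⁻¹ (F g)}
  zero_mem' g l := by simp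
  add_mem' {F F'} hF hF' g l := by simp [hF g l, hF' g l]
  smul_mem' a F hF g l := by simp [hF g l]

/-- Membership in `indFunSubmodule`. [folklore] -/
theorem mem_indFunSubmodule_iff (F : 𝒢 → N) :
    F ∈ indFunSubmodule L σ ↔ ∀ (g : 𝒢) (l : L), F (g * l) = σ l⁻¹ (F g) :=
  Iff.rfl

variable (A) in
/-- The left-translation action of `Γ` on `Fun(𝒢, N)`: `(γ F)(g) = F(ι(γ)⁻¹ g)`. [folklore] -/
def leftFunRep : Representation A Γ (𝒢 → N) where
  toFun γ := LinearMap.funLeft A N fun g => (ι γ)⁻¹ * g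
  map_one' := by
    refine LinearMap.ext fun F => funext fun g => ?_
    simp
  map_mul' γ γ' := by
    refine LinearMap.ext fun F => funext fun g => ?_
    simp [mul_assoc]

/-- Unfolding lemma for `leftFunRep`. [folklore] -/
@[simp]
theorem leftFunRep_apply (γ : Γ) (F : 𝒢 → N) (g : 𝒢) :
    leftFunRep A ι (N := N) γ F g = F ((ι γ)⁻¹ * g) :=
  rfl

/-- `indFunSubmodule` is stable under left translations. [folklore] -/
theorem leftFunRep_mem_indFunSubmodule (γ : Γ) {F : 𝒢 → N} (hF : F ∈ indFunSubmodule L σ) :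
    leftFunRep A ι γ F ∈ indFunSubmodule L σ := by
  intro g l
  rw [leftFunRep_apply, leftFunRep_apply, ← mul_assoc]
  exact hF _ l

/-- The induced-type representation as a `Γ`-subrepresentation of `Fun(𝒢, N)`. [folklore] -/
def indFunSubrep : Subrepresentation (leftFunRep A ι (𝒢 := 𝒢) (N := N)) where
  toSubmodule := indFunSubmodule L σ
  apply_mem_toSubmodule γ _ hF := leftFunRep_mem_indFunSubmodule ι L σ γ hF

/-- **`{F : 𝒢 → N | F(g l) = σ(l)⁻¹ F(g)}` with `Γ` acting by left translation**, as an object of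
`Rep A Γ`. [folklore] -/
abbrev indFun : Rep A Γ :=
  Rep.of (indFunSubrep ι L σ).toRepresentation

end IndFun

/-! ### The untwisting isomorphism `M̃ ≅ indFun (π|_L on M)` -/

section Untwist

variable (M : Submodule A V) (hM : ∀ l ∈ L, ∀ m ∈ M, π l m ∈ M)

/-- `M` as a subrepresentation of `π` restricted to `L`. [folklore] -/
def latticeSubrep : Subrepresentation (π.comp L.subtype) where
  toSubmodule := M
  apply_mem_toSubmodule l _ hm := hM l l.2 _ hm

/-- `π|_L` acting on `M`. [folklore] -/
abbrev latticeRep : Representation A L M :=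
  (latticeSubrep L π M hM).toRepresentation

/-- Unfolding lemma: `(π|_L l m : V) = π(l) m`. [folklore] -/
@[simp]
theorem coe_latticeRep_apply (l : L) (m : M) : (latticeRep L π M hM l m : V) = π l m :=
  rfl

/-- The untwisting map on elements: `f ↦ (g ↦ π(g)⁻¹ f(gL))`. [folklore] -/
def untwistFun (f : intFun ι L π M) : indFun ι L (latticeRep L π M hM) :=
  ⟨fun g => ⟨π g⁻¹ (f.1 (g : 𝒢 ⧸ L)), f.2 g⟩, fun g l => Subtype.ext (by
    change π (g * l)⁻¹ (f.1 ((g * l : 𝒢) : 𝒢 ⧸ L)) = π (l : 𝒢)⁻¹ (π g⁻¹ (f.1 (g : 𝒢 ⧸ L)))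
    rw [QuotientGroup.mk_mul_of_mem g l.2, mul_inv_rev, map_mul, Module.End.mul_apply])⟩

/-- Unfolding lemma for `untwistFun`. [folklore] -/
@[simp]
theorem coe_untwistFun_apply (f : intFun ι L π M) (g : 𝒢) :
    ((untwistFun ι L π M hM f).1 g : V) = π g⁻¹ (f.1 (g : 𝒢 ⧸ L)) :=
  rfl

/-- The twisting map on elements: `F ↦ (gL ↦ π(g) F(g))` (independent of the representative).
[folklore] -/
def twistFun (F : indFun ι L (latticeRep L π M hM)) : intFun ι L π M :=
  ⟨fun c => Quotient.liftOn' c (fun g => π g (F.1 g : V)) fun g g' hgg' => by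
      obtain ⟨l, rfl⟩ : ∃ l : L, g' = g * l :=
        ⟨⟨g⁻¹ * g', QuotientGroup.leftRel_apply.1 hgg'⟩, by simp⟩
      rw [F.2 g l, coe_latticeRep_apply, map_mul, Module.End.mul_apply, Subgroup.coe_inv,
        rep_apply_inv_apply],
    fun g => by
      change π g⁻¹ (π g (F.1 g : V)) ∈ M
      rw [rep_inv_apply_apply]
      exact (F.1 g).2⟩

/-- Unfolding lemma for `twistFun`. [folklore] -/
@[simp]
theorem coe_twistFun_apply (F : indFun ι L (latticeRep L π M hM)) (g : 𝒢) :
    (twistFun ι L π M hM F).1 (g : 𝒢 ⧸ L) = π g (F.1 g : V) :=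
  rfl

/-- The untwisting as an `A`-linear equivalence. [folklore] -/
def untwistLinearEquiv : intFun ι L π M ≃ₗ[A] indFun ι L (latticeRep L π M hM) where
  toFun := untwistFun ι L π M hM
  map_add' f f' := Subtype.ext (funext fun g => Subtype.ext (by simp))
  map_smul' a f := Subtype.ext (funext fun g => Subtype.ext (by simp))
  invFun := twistFun ι L π M hM
  left_inv f := Subtype.ext (funext fun c => by
    induction c using QuotientGroup.induction_on with
    | H g => rw [coe_twistFun_apply, coe_untwistFun_apply, rep_apply_inv_apply])
  right_inv F := Subtype.ext (funext fun g => Subtype.ext (by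
    rw [coe_untwistFun_apply, coe_twistFun_apply, rep_inv_apply_apply]))

/-- **The untwisting isomorphism `M̃ ≅ {F : 𝒢 → M | F(g l) = π(l)⁻¹ F(g)}`** of
`Γ`-representations (`Γ` acting on the right-hand side by left translation only).
[cite: Scholze2015, §V.4, proof of Thm. V.4.1] -/
def intFunIso : intFun ι L π M ≅ indFun ι L (latticeRep L π M hM) :=
  Rep.mkIso (Representation.Equiv.mk (untwistLinearEquiv ι L π M hM) fun γ =>
    LinearMap.ext fun f => Subtype.ext (funext fun g => Subtype.ext (by
      change π g⁻¹ ((coeffRepresentation ι L (π.comp ι) γ f.1) (g : 𝒢 ⧸ L)) =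
        π ((ι γ)⁻¹ * g)⁻¹ (f.1 (((ι γ)⁻¹ * g : 𝒢) : 𝒢 ⧸ L))
      rw [coeffRepresentation_apply, MonoidHom.comp_apply, MulAction.Quotient.smul_coe,
        smul_eq_mul, ← Module.End.mul_apply, ← map_mul, mul_inv_rev, inv_inv])))

/-- Unfolding lemma for `intFunIso`. [folklore] -/
@[simp]
theorem coe_intFunIso_hom_hom_apply (f : intFun ι L π M) (g : 𝒢) :
    (((intFunIso ι L π M hM).hom.hom f).1 g : V) = π g⁻¹ (f.1 (g : 𝒢 ⧸ L)) :=
  rfl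

end Untwist

end TwistedQuotient

end Literature.NumberTheory.Automorphic
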